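import Literature.Analysis.FunctionSpaces.TimeMollification
import HarnessLib

/-!
# Serrin's doubling of the time variable (abstract form)

Analysis/FunctionSpaces support file (serves the discharge of the Serrin–Prodi weak–strong
uniqueness theorem `Literature.Analysis.FluidPDE.weak_strong_uniqueness`, sub-fact `Literature.Analysis.FluidPDE.serrin_difference_energy_ineq`:
the "cross identity" `⟨u(t),v(t)⟩ + 2ν∫⟨∇u,∇v⟩ = ‖u₀‖² + ∫(trilinear terms)` for two Leray–Hopf
solutions is obtained by testing each weak formulation with the time mollification of the other
solution; Serrin 1963, §4; Sohr 2001, proof of Thm. V.1.4.1; Galdi 2000, proof of Thm. 4.2).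

This file isolates the real-variable skeleton of that argument.

**Main result** (`Literature.Analysis.FunctionSpaces.doubling_identity`). Let `t > 0` and `Q : (0,t]² → ℝ` be bounded and
measurable, and suppose
* for a.e. `σ`, `s ↦ Q(s,σ)` is absolutely continuous from the left end:
  `Q(s,σ) = c(σ) + ∫₀ˢ f(σ,τ) dτ` for all `s ∈ (0,t]`, with `f(σ,·) ∈ L¹(0,t)`;
* for a.e. `s`, `σ ↦ Q(s,σ) = c'(s) + ∫₀^σ g(s,τ) dτ` for all `σ ∈ (0,t]`, `g(s,·) ∈ L¹(0,t)`;
* `σ ↦ Q(t,σ)`, `s ↦ Q(s,t)`, `c`, `c'` are continuous on `(0,t)`, with `Q(t,σ) → Q(t,t)`,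
  `Q(s,t) → Q(t,t)` as `σ, s → t⁻` and `c(σ), c'(s) → L₀` as `σ, s → 0⁺`;
* along a sequence of even bump kernels `ρₙ` with `rOut → 0`, the mollified bulk terms converge:
  `∫∫ ρₙ(s-σ) f(σ,s) → B_f`, `∫∫ ρₙ(s-σ) g(s,σ) → B_g`.
Then `Q(t,t) = L₀ + B_f + B_g`.

**Proof** (Serrin 1963, §4). Compute `Iₙ = ∫∫ ρₙ'(s-σ) Q(s,σ)` twice by Fubini: integrating first
in `s` and by parts against the primitive in `s` (`setIntegral_deriv_mul_const_add_setIntegral`),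
then first in `σ` and by parts in `σ`. The boundary terms are half-kernel integrals
`∫ ρₙ(t-σ) Q(t,σ) dσ → ½Q(t,t)` and `∫ ρₙ(σ) c(σ) dσ → ½L₀`
(`tendsto_setIntegral_normed_sub_mul`, `tendsto_setIntegral_normed_mul`), and letting `n → ∞` in
the resulting identity gives the claim.

## Mathlib search

Pure bookkeeping over the accepted `TimeMollification` toolkit and Mathlib's Fubini
(`integral_prod`, `integral_prod_symm`); no comparable statement exists in Mathlib (searched
`mollif`, `doubling`, `integral_prod_symm` users in `Analysis`).

## References

* J. Serrin, *The initial value problem for the Navier–Stokes equations*, in: Nonlinear Problems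
  (Madison 1962), Univ. Wisconsin Press 1963, §4 (`Serrin1963`).
* H. Sohr, *The Navier–Stokes Equations. An Elementary Functional Analytic Approach*,
  Birkhäuser 2001, Thm. V.1.4.1.
-/

noncomputable section

open MeasureTheory TopologicalSpace Set Function Filter Topology ContinuousLinearMap Metric
open scoped ENNReal NNReal Convolution

namespace Literature.Analysis.FunctionSpaces

/-- The derivative of the normalised bump kernel is bounded. [folklore] -/
theorem exists_abs_deriv_normed_le (φ : ContDiffBump (0 : ℝ)) :
    ∃ C, 0 ≤ C ∧ ∀ x, |deriv (φ.normed volume) x| ≤ C := by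
  have hc : Continuous (deriv (φ.normed volume)) :=
    (φ.contDiff_normed (n := 1)).continuous_deriv le_rfl
  have hK : HasCompactSupport (deriv (φ.normed volume)) := φ.hasCompactSupport_normed.deriv
  obtain ⟨C, hC⟩ := hc.bounded_above_of_compact_support hK
  refine ⟨C, (norm_nonneg _).trans (hC 0), fun x => ?_⟩
  rw [← Real.norm_eq_abs]; exact hC x

/-- A continuous function on `(0, t)`, bounded there, multiplied by a continuous weight, is
integrable on `(0, t)`. [folklore] -/
theorem integrableOn_Ioo_mul_of_continuousOn_of_bound {t : ℝ} {w h : ℝ → ℝ} (hw : Continuous w)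
    (hh : ContinuousOn h (Ioo 0 t)) {B : ℝ} (hB : ∀ x ∈ Ioo 0 t, |h x| ≤ B) :
    IntegrableOn (fun x => w x * h x) (Ioo 0 t) := by
  obtain ⟨C, hC⟩ := (isCompact_Icc (a := 0) (b := t)).exists_bound_of_continuousOn hw.continuousOn
  have hm : AEStronglyMeasurable (fun x => w x * h x) (volume.restrict (Ioo 0 t)) :=
    (hw.aestronglyMeasurable.restrict).mul (hh.aestronglyMeasurable measurableSet_Ioo)
  refine Integrable.mono' (integrable_const (C * |B|)) hm ?_
  filter_upwards [ae_restrict_mem measurableSet_Ioo] with x hx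
  rw [norm_mul, Real.norm_eq_abs, Real.norm_eq_abs]
  exact mul_le_mul (by simpa [Real.norm_eq_abs] using hC x (Ioo_subset_Icc_self hx))
    ((hB x hx).trans (le_abs_self B)) (abs_nonneg _) ((norm_nonneg _).trans (hC x (Ioo_subset_Icc_self hx)))

/-- **Serrin's doubling identity (abstract form).** See the module docstring for the statement;
`p = (σ, s)` is the variable on the square `(0,t)²`, the kernels enter as `ρₙ(p.2 - p.1)`,
`f σ s` is the `s`-density of `s ↦ Q s σ` and `g s σ` the `σ`-density of `σ ↦ Q s σ`
(Serrin 1963, §4: the identity obtained by testing each mollified weak formulation with the other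
solution, before the limit in the mollification parameter, and that limit). [cite: Serrin1963, §4] -/
theorem doubling_identity {t : ℝ} (ht : 0 < t) {Q : ℝ → ℝ → ℝ} {c c' : ℝ → ℝ}
    {f g : ℝ → ℝ → ℝ} {L₀ Bf Bg B : ℝ}
    (hQm : AEStronglyMeasurable (fun p : ℝ × ℝ => Q p.2 p.1)
      ((volume.restrict (Ioo 0 t)).prod (volume.restrict (Ioo 0 t))))
    (hQb : ∀ s ∈ Ioc 0 t, ∀ σ ∈ Ioc 0 t, |Q s σ| ≤ B)
    (hA : ∀ᵐ σ ∂(volume.restrict (Ioo 0 t)), IntegrableOn (f σ) (Ioo 0 t) ∧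
      ∀ s ∈ Ioc 0 t, Q s σ = c σ + ∫ τ in Ioo 0 s, f σ τ)
    (hB : ∀ᵐ s ∂(volume.restrict (Ioo 0 t)), IntegrableOn (g s) (Ioo 0 t) ∧
      ∀ σ ∈ Ioc 0 t, Q s σ = c' s + ∫ τ in Ioo 0 σ, g s τ)
    (hQ₁ : ContinuousOn (fun σ => Q t σ) (Ioo 0 t))
    (hQ₁' : Tendsto (fun σ => Q t σ) (𝓝[<] t) (𝓝 (Q t t)))
    (hQ₂ : ContinuousOn (fun s => Q s t) (Ioo 0 t))
    (hQ₂' : Tendsto (fun s => Q s t) (𝓝[<] t) (𝓝 (Q t t)))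
    (hc : ContinuousOn c (Ioo 0 t)) (hcb : ∀ σ ∈ Ioo 0 t, |c σ| ≤ B)
    (hc0 : Tendsto c (𝓝[>] 0) (𝓝 L₀))
    (hc' : ContinuousOn c' (Ioo 0 t)) (hc'b : ∀ s ∈ Ioo 0 t, |c' s| ≤ B)
    (hc'0 : Tendsto c' (𝓝[>] 0) (𝓝 L₀))
    {φ : ℕ → ContDiffBump (0 : ℝ)} (hφ : Tendsto (fun n => (φ n).rOut) atTop (𝓝 0))
    (hfF : ∀ n, Integrable (fun p : ℝ × ℝ => (φ n).normed volume (p.2 - p.1) * f p.1 p.2)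
      ((volume.restrict (Ioo 0 t)).prod (volume.restrict (Ioo 0 t))))
    (hgF : ∀ n, Integrable (fun p : ℝ × ℝ => (φ n).normed volume (p.2 - p.1) * g p.2 p.1)
      ((volume.restrict (Ioo 0 t)).prod (volume.restrict (Ioo 0 t))))
    (hf_lim : Tendsto (fun n => ∫ p, (φ n).normed volume (p.2 - p.1) * f p.1 p.2
      ∂((volume.restrict (Ioo 0 t)).prod (volume.restrict (Ioo 0 t)))) atTop (𝓝 Bf))
    (hg_lim : Tendsto (fun n => ∫ p, (φ n).normed volume (p.2 - p.1) * g p.2 p.1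
      ∂((volume.restrict (Ioo 0 t)).prod (volume.restrict (Ioo 0 t)))) atTop (𝓝 Bg)) :
    Q t t = L₀ + Bf + Bg := by
  have hSm : MeasurableSet (Ioo (0 : ℝ) t) := measurableSet_Ioo
  have hSsub : Ioo (0 : ℝ) t ⊆ Ioc 0 t := Ioo_subset_Ioc_self
  have htI : t ∈ Ioc 0 t := ⟨ht, le_rfl⟩
  -- the four boundary sequences and the two bulk sequences
  set X₁ : ℕ → ℝ := fun n => ∫ σ in Ioo 0 t, (φ n).normed volume (t - σ) * Q t σ with hX₁
  set Y₁ : ℕ → ℝ := fun n => ∫ s in Ioo 0 t, (φ n).normed volume (t - s) * Q s t with hY₁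
  set X₂ : ℕ → ℝ := fun n => ∫ σ in Ioo 0 t, (φ n).normed volume σ * c σ with hX₂
  set Y₂ : ℕ → ℝ := fun n => ∫ s in Ioo 0 t, (φ n).normed volume s * c' s with hY₂
  set X₃ : ℕ → ℝ := fun n => ∫ p, (φ n).normed volume (p.2 - p.1) * f p.1 p.2 ∂((volume.restrict (Ioo 0 t)).prod (volume.restrict (Ioo 0 t))) with hX₃
  set Y₃ : ℕ → ℝ := fun n => ∫ p, (φ n).normed volume (p.2 - p.1) * g p.2 p.1 ∂((volume.restrict (Ioo 0 t)).prod (volume.restrict (Ioo 0 t))) with hY₃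
  -- ### the identity at stage `n`
  have hstar : ∀ n, X₁ n + Y₁ n = X₂ n + Y₂ n + X₃ n + Y₃ n := by
    intro n
    set ρ : ℝ → ℝ := (φ n).normed volume with hρ
    have hρ1 : ContDiff ℝ 1 ρ := (φ n).contDiff_normed
    have hρc : Continuous ρ := (φ n).continuous_normed
    have hρ'c : Continuous (deriv ρ) := hρ1.continuous_deriv le_rfl
    obtain ⟨C', hC'0, hC'⟩ := exists_abs_deriv_normed_le (φ n)
    have hρeven : ∀ x, ρ (-x) = ρ x := fun x => (φ n).normed_neg x
    -- the doubled integrand and its integrability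
    have hI : Integrable (fun p : ℝ × ℝ => deriv ρ (p.2 - p.1) * Q p.2 p.1) ((volume.restrict (Ioo 0 t)).prod (volume.restrict (Ioo 0 t))) := by
      have hm : AEStronglyMeasurable (fun p : ℝ × ℝ => deriv ρ (p.2 - p.1) * Q p.2 p.1) ((volume.restrict (Ioo 0 t)).prod (volume.restrict (Ioo 0 t))) :=
        ((hρ'c.comp (continuous_snd.sub continuous_fst)).aestronglyMeasurable).mul hQm
      refine Integrable.mono' (integrable_const (C' * |B|)) hm ?_
      have hae : ∀ᵐ p ∂((volume.restrict (Ioo 0 t)).prod (volume.restrict (Ioo 0 t))),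
          p ∈ Ioo (0 : ℝ) t ×ˢ Ioo (0 : ℝ) t := by
        rw [Measure.prod_restrict]
        exact ae_restrict_mem (hSm.prod hSm)
      filter_upwards [hae] with p hp
      rw [norm_mul, Real.norm_eq_abs, Real.norm_eq_abs]
      exact mul_le_mul (hC' _) ((hQb _ (hSsub hp.2) _ (hSsub hp.1)).trans (le_abs_self B))
        (abs_nonneg _) hC'0
    -- (A) integrate first in `s`
    have hAi : ∀ᵐ σ ∂(volume.restrict (Ioo 0 t)), ∫ s in Ioo 0 t, deriv ρ (s - σ) * Q s σ =
        ρ (t - σ) * Q t σ - ρ σ * c σ - ∫ s in Ioo 0 t, ρ (s - σ) * f σ s := by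
      filter_upwards [hA] with σ hσ
      obtain ⟨hfσ, hrep⟩ := hσ
      have hθ : ContDiff ℝ 1 fun s => ρ (s - σ) := hρ1.comp (contDiff_id.sub contDiff_const)
      have hθ' : ∀ s, deriv (fun s => ρ (s - σ)) s = deriv ρ (s - σ) := fun s =>
        deriv_comp_sub_const ρ σ s
      have hibp := setIntegral_deriv_mul_const_add_setIntegral ht hθ hfσ (c σ)
      simp only [hθ'] at hibp
      have hlhs : ∫ s in Ioo 0 t, deriv ρ (s - σ) * Q s σ =
          ∫ s in Ioo 0 t, deriv ρ (s - σ) * (c σ + ∫ τ in Ioo 0 s, f σ τ) :=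
        setIntegral_congr_fun hSm fun s hs => by rw [hrep s (hSsub hs)]
      rw [hlhs, hibp, ← hrep t htI, zero_sub, hρeven]
    -- (B) integrate first in `σ`
    have hBi : ∀ᵐ s ∂(volume.restrict (Ioo 0 t)), ∫ σ in Ioo 0 t, deriv ρ (s - σ) * Q s σ =
        -(ρ (t - s) * Q s t) + ρ s * c' s + ∫ σ in Ioo 0 t, ρ (s - σ) * g s σ := by
      filter_upwards [hB] with s hs
      obtain ⟨hgs, hrep⟩ := hs
      have hθ : ContDiff ℝ 1 fun σ => -ρ (s - σ) := (hρ1.comp (contDiff_const.sub contDiff_id)).neg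
      have hθ' : ∀ σ, deriv (fun σ => -ρ (s - σ)) σ = deriv ρ (s - σ) := by
        intro σ
        rw [show (fun σ => -ρ (s - σ)) = -(fun σ => ρ (s - σ)) from rfl, deriv.neg,
          deriv_comp_const_sub ρ s σ, neg_neg]
      have hibp := setIntegral_deriv_mul_const_add_setIntegral ht hθ hgs (c' s)
      simp only [hθ'] at hibp
      have hlhs : ∫ σ in Ioo 0 t, deriv ρ (s - σ) * Q s σ =
          ∫ σ in Ioo 0 t, deriv ρ (s - σ) * (c' s + ∫ τ in Ioo 0 σ, g s τ) :=
        setIntegral_congr_fun hSm fun σ hσ => by rw [hrep σ (hSsub hσ)]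
      have hρsub : ∀ a b : ℝ, ρ (a - b) = ρ (b - a) := fun a b => normed_sub_comm (φ n) a b
      rw [hlhs, hibp, ← hrep t htI, hρsub s t]
      have : ∫ σ in Ioo 0 t, -ρ (s - σ) * g s σ = -∫ σ in Ioo 0 t, ρ (s - σ) * g s σ := by
        rw [← integral_neg]; congr 1; ext σ; ring
      rw [this]
      simp only [sub_zero]
      ring
    -- integrability of the pieces in the outer variables
    have i₁ : IntegrableOn (fun σ => ρ (t - σ) * Q t σ) (Ioo 0 t) :=
      integrableOn_Ioo_mul_of_continuousOn_of_bound (hρc.comp (continuous_const.sub continuous_id))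
        hQ₁ fun σ hσ => hQb t htI σ (hSsub hσ)
    have i₂ : IntegrableOn (fun σ => ρ σ * c σ) (Ioo 0 t) :=
      integrableOn_Ioo_mul_of_continuousOn_of_bound hρc hc hcb
    have i₃ : Integrable (fun σ => ∫ s, ρ (s - σ) * f σ s ∂(volume.restrict (Ioo 0 t))) (volume.restrict (Ioo 0 t)) := (hfF n).integral_prod_left
    have j₁ : IntegrableOn (fun s => ρ (t - s) * Q s t) (Ioo 0 t) :=
      integrableOn_Ioo_mul_of_continuousOn_of_bound (hρc.comp (continuous_const.sub continuous_id))
        hQ₂ fun s hs => hQb s (hSsub hs) t htI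
    have j₂ : IntegrableOn (fun s => ρ s * c' s) (Ioo 0 t) :=
      integrableOn_Ioo_mul_of_continuousOn_of_bound hρc hc' hc'b
    have j₃ : Integrable (fun s => ∫ σ, ρ (s - σ) * g s σ ∂(volume.restrict (Ioo 0 t))) (volume.restrict (Ioo 0 t)) := by
      have h := (hgF n).integral_prod_right
      exact h
    -- evaluate `Iₙ` both ways
    have i12 : Integrable (fun σ => ρ (t - σ) * Q t σ - ρ σ * c σ) (volume.restrict (Ioo 0 t)) :=
      i₁.sub i₂
    have hIA : ∫ p, deriv ρ (p.2 - p.1) * Q p.2 p.1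
        ∂((volume.restrict (Ioo 0 t)).prod (volume.restrict (Ioo 0 t))) = X₁ n - X₂ n - X₃ n := by
      rw [integral_prod _ hI]
      change ∫ σ, ∫ s, deriv ρ (s - σ) * Q s σ ∂(volume.restrict (Ioo 0 t))
        ∂(volume.restrict (Ioo 0 t)) = _
      have hX₃' : X₃ n = ∫ σ, ∫ s, ρ (s - σ) * f σ s ∂(volume.restrict (Ioo 0 t))
          ∂(volume.restrict (Ioo 0 t)) := by
        simp only [hX₃]; exact integral_prod _ (hfF n)
      rw [integral_congr_ae hAi, integral_sub i12 i₃, integral_sub i₁ i₂, hX₃']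
    have j1' : Integrable (fun s => -(ρ (t - s) * Q s t)) (volume.restrict (Ioo 0 t)) := j₁.neg
    have j12 : Integrable (fun s => -(ρ (t - s) * Q s t) + ρ s * c' s) (volume.restrict (Ioo 0 t)) :=
      j1'.add j₂
    have hIB : ∫ p, deriv ρ (p.2 - p.1) * Q p.2 p.1
        ∂((volume.restrict (Ioo 0 t)).prod (volume.restrict (Ioo 0 t))) = -Y₁ n + Y₂ n + Y₃ n := by
      rw [integral_prod_symm _ hI]
      change ∫ s, ∫ σ, deriv ρ (s - σ) * Q s σ ∂(volume.restrict (Ioo 0 t))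
        ∂(volume.restrict (Ioo 0 t)) = _
      have hY₃' : Y₃ n = ∫ s, ∫ σ, ρ (s - σ) * g s σ ∂(volume.restrict (Ioo 0 t))
          ∂(volume.restrict (Ioo 0 t)) := by
        simp only [hY₃]; exact integral_prod_symm _ (hgF n)
      rw [integral_congr_ae hBi, integral_add j12 j₃, integral_add j1' j₂,
        integral_neg, hY₃']
    have := hIA.symm.trans hIB
    linarith
  -- ### the limits
  have hB' : ∀ σ ∈ Ioo 0 t, |Q t σ| ≤ B := fun σ hσ => hQb t htI σ (hSsub hσ)
  have hB'' : ∀ s ∈ Ioo 0 t, |Q s t| ≤ B := fun s hs => hQb s (hSsub hs) t htI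
  have hX₁ : Tendsto X₁ atTop (𝓝 (Q t t / 2)) :=
    tendsto_setIntegral_normed_sub_mul hφ ht hQ₁ hB' hQ₁'
  have hY₁ : Tendsto Y₁ atTop (𝓝 (Q t t / 2)) :=
    tendsto_setIntegral_normed_sub_mul hφ ht hQ₂ hB'' hQ₂'
  have hX₂ : Tendsto X₂ atTop (𝓝 (L₀ / 2)) :=
    tendsto_setIntegral_normed_mul hφ ht hc hcb hc0
  have hY₂ : Tendsto Y₂ atTop (𝓝 (L₀ / 2)) :=
    tendsto_setIntegral_normed_mul hφ ht hc' hc'b hc'0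
  have hL : Tendsto (fun n => X₁ n + Y₁ n) atTop (𝓝 (Q t t / 2 + Q t t / 2)) := hX₁.add hY₁
  have hR : Tendsto (fun n => X₂ n + Y₂ n + X₃ n + Y₃ n) atTop
      (𝓝 (L₀ / 2 + L₀ / 2 + Bf + Bg)) := ((hX₂.add hY₂).add hf_lim).add hg_lim
  have heq : (fun n => X₁ n + Y₁ n) = fun n => X₂ n + Y₂ n + X₃ n + Y₃ n := funext hstar
  rw [heq] at hL
  have := tendsto_nhds_unique hL hR
  linarith

end Literature.Analysis.FunctionSpaces
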